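import Literature.AlgebraicGeometry.AbelianSchemes.AbelianSchemeOverLevelBaseChange
import Mathlib.AlgebraicGeometry.Morphisms.Smooth
import Mathlib.AlgebraicGeometry.Morphisms.Proper
import HarnessLib

/-!
# The group law INDUCED BY A POINT of a law-carrying base: transport of `G_Z` along `T → Z` ([MumfordFogartyKirwan1994] Ch. 6 §3, p. 126)

Topic `Literature/AlgebraicGeometry/AbelianSchemes`; namespace `Literature.AlgebraicGeometry.AbelianSchemes`.  ONE THEOREM (no definition,
no named fact, no instance, no notation, no `sorry`); universe-polymorphic.  Cell hodgecm-mathlib (D-0151 ∕ FLOOR 0), P1 sub-line F-4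
`F4LinearRigidificationII`, layer 2, the (G3) TRANSPORT tool of the typer's menu — **B-typ03 (g19)'s seed `InducedLawOfPoint` c5995478, Literature-side**;
home of record = this leaf (F-4 lead B-p17 (g15) 2026-08-30T19:55:03Z); consumed BY NAME by ★-to-be `AbelianSchemes/GroupLawLocusAssembly` ((II-e)),
`Morphisms/LawLocusOfHomScheme` ((II-c₁), clause (A)) and the (II-c₂) seed.  HC_CM is proved only modulo the 7 printed citations until rung 0
closes; this file discharges none of them.

THE STATEMENT.  For `p : X → S` proper smooth with geometrically connected fibres and a section `ε`, ANY `ω : Z → S` with a group law `G_Z` on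
`X ×_S Z → Z` whose unit read in `X` is `ω ≫ ε`, and any `w : T → Z` over `v : T → S` with the canonical comparison `κ : X ×_S T → X ×_S Z`
(`κ ≫ pr_X = pr_X`, `κ ≫ pr_Z = pr_T ≫ w`): the law `G_Z` INDUCES a group law `G'` on `X ×_S T → T` with unit `v ≫ ε`, intertwined with `G_Z` by `κ`
on units and multiplications.  PROOF: package `(X ×_S Z, G_Z)` as ★ `AbelianSchemeOver Z`, base-change it along `w` (★ `baseChange`, ★
`one_∕mul_baseChange_left_comp_fst`), and move the group object along the pasting isomorphism `(X ×_S Z) ×_Z T ≅ X ×_S T` of `Over T` (Mathlib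
`GrpObj.ofIso`) — [MumfordFogartyKirwan1994] Ch. 7 §2 Def. 7.2 (p. 129): base change of group schemes.

## References
* [MumfordFogartyKirwan1994] D. Mumford, J. Fogarty, F. Kirwan, *Geometric Invariant Theory*, 3rd ed. (1994), Ch. 6 §3 Proposition 6.16, proof
  (p. 126); Ch. 7 §2 Definition 7.2 (p. 129).
* [GortzWedhorn2020] U. Görtz, T. Wedhorn, *Algebraic Geometry I*, 2nd ed. (2020), Section (4.7) (base change and its pasting).
-/

set_option autoImplicit false

-- Mathlib's `Over`/pull-back API is stated across semireducible wrappers (as in the ★ `AbelianSchemes/*` files).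
set_option backward.isDefEq.respectTransparency false

universe u

open CategoryTheory CategoryTheory.Limits AlgebraicGeometry MonoidalCategory

namespace Literature.AlgebraicGeometry.AbelianSchemes

open scoped MonObj

/-! ### §1 (G3) The group law induced by a point: transport of `G_Z` along `T → Z` -/

/-- **The law induced by a point** (the (G3) transport of the F-4 menu; B-typ03 (g19) seed `InducedLawOfPoint`, here
Literature-side and universe-polymorphic).  For `p : X → S` proper smooth with geometrically connected fibres, `ε : S → X`,
ANY `ω : Z → S` with a group law `G_Z` on `X ×_S Z → Z` (an object `GrpObj (Over.mk (pullback.snd p ω))`) whose unit read in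
`X` is `ω ≫ ε`, and any `w : T → Z` over `v : T → S` with the canonical `κ : X ×_S T → X ×_S Z` (`κ ≫ pr_X = pr_X`,
`κ ≫ pr_Z = pr_T ≫ w`): `G_Z` INDUCES a group law on `X ×_S T → T` with unit `v ≫ ε`, intertwined with `G_Z` by `κ` on units
and multiplications.  Proof = transport: package `(X ×_S Z, G_Z)` as ★ `AbelianSchemeOver Z`, take ★ `AbelianSchemeOver.baseChange w`
(★ `one_baseChange_left_comp_fst`, ★ `mul_baseChange_left_comp_fst`), and move the structure along the canonical iso
`(X ×_S Z) ×_Z T ≅ X ×_S T` in `Over T` (Mathlib `GrpObj.ofIso`; the square `(κ, pr_T; pr_Z, w)` is cartesian by pasting).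
[MumfordFogartyKirwan1994] Ch. 7 §2 Def. 7.2 (p. 129) is the print's «`X ×_S T` … in the obvious way»; Ch. 6 §3 p. 126 uses
it silently. [cite: MumfordFogartyKirwan1994, Ch. 7 §2 Definition 7.2 (p. 129); Ch. 6 §3 Proposition 6.16, proof (p. 126)] -/
theorem AbelianSchemeOver.exists_inducedLaw_of_point {S X Z T : Scheme.{u}} (p : X ⟶ S) [IsProper p] [Smooth p]
    [GeometricallyConnected p] (ε : S ⟶ X) (ω : Z ⟶ S) (GZ : GrpObj (Over.mk (pullback.snd p ω)))
    (hunit : (@MonObj.one _ _ _ (Over.mk (pullback.snd p ω)) GZ.toMonObj).left ≫ pullback.fst p ω = ω ≫ ε)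
    {v : T ⟶ S} (w : T ⟶ Z) (hw : w ≫ ω = v)
    (κ : pullback p v ⟶ pullback p ω) (hκ₁ : κ ≫ pullback.fst p ω = pullback.fst p v)
    (hκ : κ ≫ pullback.snd p ω = pullback.snd p v ≫ w) :
    ∃ G' : GrpObj (Over.mk (pullback.snd p v)),
      (@MonObj.one _ _ _ (Over.mk (pullback.snd p v)) G'.toMonObj).left ≫ pullback.fst p v = v ≫ ε ∧
      (@MonObj.one _ _ _ (Over.mk (pullback.snd p v)) G'.toMonObj).left ≫ κ =
        w ≫ (@MonObj.one _ _ _ (Over.mk (pullback.snd p ω)) GZ.toMonObj).left ∧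
      (@MonObj.mul _ _ _ (Over.mk (pullback.snd p v)) G'.toMonObj).left ≫ κ =
        pullback.map (pullback.snd p v) (pullback.snd p v) (pullback.snd p ω) (pullback.snd p ω) κ κ w
          hκ.symm hκ.symm ≫ (@MonObj.mul _ _ _ (Over.mk (pullback.snd p ω)) GZ.toMonObj).left := by
  -- `(X ×_S Z, G_Z)` as an abelian scheme over `Z`, and its base change along `w`
  let 𝒜 : AbelianSchemeOver Z := @AbelianSchemeOver.mk Z (Over.mk (pullback.snd p ω)) GZ
    (show IsProper (pullback.snd p ω) from inferInstance) (show Smooth (pullback.snd p ω) from inferInstance)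
    (show GeometricallyConnected (pullback.snd p ω) from inferInstance)
  have hη : η[(𝒜.baseChange w).X].left ≫ pullback.fst (pullback.snd p ω) w =
      w ≫ (@MonObj.one _ _ _ (Over.mk (pullback.snd p ω)) GZ.toMonObj).left :=
    𝒜.one_baseChange_left_comp_fst w
  have hμ : μ[(𝒜.baseChange w).X].left ≫ pullback.fst (pullback.snd p ω) w =
      pullback.map (𝒜.baseChange w).X.hom (𝒜.baseChange w).X.hom (pullback.snd p ω) (pullback.snd p ω)
        (pullback.fst (pullback.snd p ω) w) (pullback.fst (pullback.snd p ω) w) w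
        pullback.condition.symm pullback.condition.symm ≫
        (@MonObj.mul _ _ _ (Over.mk (pullback.snd p ω)) GZ.toMonObj).left :=
    𝒜.mul_baseChange_left_comp_fst w pullback.condition
  -- the square `(κ, pr_T ; pr_Z, w)` is cartesian (pasting)
  have big : IsPullback (κ ≫ pullback.fst p ω) (pullback.snd p v) p (w ≫ ω) := by
    rw [hκ₁, hw]; exact IsPullback.of_hasPullback p v
  have sq : IsPullback κ (pullback.snd p v) (pullback.snd p ω) w :=
    IsPullback.of_right big hκ (IsPullback.of_hasPullback p ω)
  -- `(X ×_S Z) ×_Z T ≅ X ×_S T` in `Over T`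
  let eO : (𝒜.baseChange w).X ≅ Over.mk (pullback.snd p v) :=
    Over.isoMk sq.isoPullback.symm sq.isoPullback_inv_snd
  have heκ : eO.hom.left ≫ κ = pullback.fst (pullback.snd p ω) w := sq.isoPullback_inv_fst
  have heκ' : eO.inv.left ≫ pullback.fst (pullback.snd p ω) w = κ := sq.isoPullback_hom_fst
  refine ⟨GrpObj.ofIso eO, ?_, ?_, ?_⟩
  · -- the unit, read in `X`
    change (η[(𝒜.baseChange w).X] ≫ eO.hom).left ≫ pullback.fst p v = v ≫ ε
    rw [Over.comp_left, Category.assoc, ← hκ₁, reassoc_of% heκ, reassoc_of% hη, hunit, reassoc_of% hw]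
  · -- the unit is carried by `κ` to the unit of `G_Z` over `w`
    change (η[(𝒜.baseChange w).X] ≫ eO.hom).left ≫ κ = _
    rw [Over.comp_left, Category.assoc, heκ, hη]
  · -- the multiplication is carried by `κ ×_w κ` to the multiplication of `G_Z`
    change ((eO.inv ⊗ₘ eO.inv) ≫ μ[(𝒜.baseChange w).X] ≫ eO.hom).left ≫ κ = _
    rw [Over.comp_left, Over.comp_left, Category.assoc, Category.assoc, heκ, hμ, ← Category.assoc]
    congr 1
    rw [Over.tensorHom_left]
    apply pullback.hom_ext
    · simp only [Category.assoc, pullback.lift_fst, pullback.lift_fst_assoc, heκ']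
      rfl
    · simp only [Category.assoc, pullback.lift_snd, pullback.lift_snd_assoc, heκ']
      rfl

end Literature.AlgebraicGeometry.AbelianSchemes
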